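import Summits.Parity.GeneralizedHardyLittlewood.Theorems.BeyondDiagonalBeatsQuarter.OffDiagBlockStrata
import Summits.Parity.GeneralizedHardyLittlewood.Theorems.BeyondDiagonalBeatsQuarter.OffDiagDualSwitchForm
import Summits.Parity.GeneralizedHardyLittlewood.Theorems.BeyondDiagonalBeatsQuarter.OffDiagLevelLargeSieve
import Summits.Parity.GeneralizedHardyLittlewood.Theorems.BeyondDiagonalBeatsQuarter.OffDiagLevelAPBridge
import HarnessLib

/-!
# Route `PrimeLevelFamEdge`, crux K_B (stmt-Parity-20343), line `diagonal_kernel_split` rev 4, plan Ω —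
# lead key `OffDiagCoreSplit` (16:35:30Z), part 1 `OffDiagCoreKernels`: **the stratum data of a switched pair `(h₁, s)` and
# the three LEVEL KERNELS (principal / small conductor / large conductor) whose sum is the divisor condition of the switch**

For a Petersson index `c`, a dual modulus `h₁` that is a unit mod `q·c` and a shift `s`, the divisor condition of the switched
dual series, `h₁ ∣ A + (qc)·s` (`A = ab` the product of the Kloosterman frequencies), is a CLASS condition on the level `q`:
with `g = gcd(c·s, h₁)` (`switchGcd`), `n = |h₁|/g` (`switchMod`) and `a = −(A/g)((cs)/g)⁻¹ mod n` (`switchClass`) it reads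
`g ∣ A ∧ q ≡ a (mod n)` (Strata `dvd_add_mul_iff_of_gcd`, `dvd_iff_natCast_level_eq`); and the class indicator of ONE level is
the sum of the three kernels `levelPrincipal {q} 1 n`, `levelSmallPart R {q} 1 n a`, `levelLargePart R {q} 1 n a` (prover-7's
three-part split `levelAPSum_eq_principal_add_smallPart_add_largePart` on the singleton level set; an EMPTY class when `a` is
not a unit, since `q` is coprime to `h₁`):

* `switchGcd`, `switchMod`, `switchClass` (definitions) and their bookkeeping (`switchMod_ne_zero`, `natCast_switchMod_dvd`);
* **`ite_dvd_eq_kernels`** — `𝟙[h₁ ∣ A + (qc)s] = 𝟙[g ∣ A ∧ a unit]·(K_P + K_S + K_L)(q)`;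
* `norm_kernels_le` — each kernel has norm `≤ 1`;
* `sum_levelPrincipal_singleton_mul`, `sum_levelSmallPart_singleton_mul`, `sum_levelLargePart_singleton_mul` — the kernels
  summed against a level weight over a finite level set ARE `levelPrincipal/levelSmallPart/levelLargePart` of that weight
  (so the pieces `coreP/coreS/coreL` of `OffDiagCoreSplit` are read by A8P/L8/L7d in prover-7's vocabulary).

Definitions + finite algebra; standard axioms. Helper toward `stub_offDiagBelowSlack_io`; closes nothing.
«The programme SEARCHES and TYPES; no claim about Landau–Siegel zeros, Theorems 1–2 of arXiv:2211.02515 or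
a repaired Margin232 until a kernel theorem says so.»
-/

noncomputable section

open Finset

namespace Summit.Parity.GeneralizedHardyLittlewood.Theorems.BeyondDiagonalBeatsQuarter.OffDiag

/-! ### §1. The stratum data of a switched pair `(h₁, s)` and the level kernels -/

/-- The common factor `g = gcd(c·s, h₁)` of a switched pair (`c` the Petersson index). [folklore] -/
def switchGcd (c : ℕ) (s h₁ : ℤ) : ℕ := Int.gcd ((c : ℤ) * s) h₁

/-- The reduced modulus `|h₁| / g` of a switched pair. [folklore] -/
def switchMod (c : ℕ) (s h₁ : ℤ) : ℕ := (h₁ / (switchGcd c s h₁ : ℤ)).natAbs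

/-- The class `−(A/g)·((c·s)/g)⁻¹ (mod |h₁|/g)` of the levels solving `h₁ ∣ A + q·c·s` (`A = ab`). [folklore] -/
def switchClass (c : ℕ) (A s h₁ : ℤ) : ZMod (switchMod c s h₁) :=
  -((A / (switchGcd c s h₁ : ℤ) : ℤ) : ZMod (switchMod c s h₁)) *
    ((((c : ℤ) * s / (switchGcd c s h₁ : ℤ) : ℤ) : ZMod (switchMod c s h₁)))⁻¹

/-- `g = switchGcd` divides `h₁`. [folklore] -/
theorem natCast_switchGcd_dvd (c : ℕ) (s h₁ : ℤ) : (switchGcd c s h₁ : ℤ) ∣ h₁ :=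
  Int.gcd_dvd_right ((c : ℤ) * s) h₁

/-- `switchGcd ≠ 0` for `h₁ ≠ 0`. [folklore] -/
theorem natCast_switchGcd_ne_zero (c : ℕ) (s : ℤ) {h₁ : ℤ} (hh₁ : h₁ ≠ 0) : (switchGcd c s h₁ : ℤ) ≠ 0 := by
  rw [switchGcd]
  exact_mod_cast (Int.gcd_pos_of_ne_zero_right _ hh₁).ne'

/-- `switchMod ≠ 0` for `h₁ ≠ 0`. [folklore] -/
theorem switchMod_ne_zero (c : ℕ) (s : ℤ) {h₁ : ℤ} (hh₁ : h₁ ≠ 0) : switchMod c s h₁ ≠ 0 := by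
  rw [switchMod, ne_eq, Int.natAbs_eq_zero]
  intro h
  have hmul := Int.mul_ediv_cancel' (natCast_switchGcd_dvd c s h₁)
  rw [h, mul_zero] at hmul
  exact hh₁ hmul.symm

/-- `switchMod ∣ h₁` (the reduced modulus `h₁/g` divides `h₁`). [folklore] -/
theorem natCast_switchMod_dvd (c : ℕ) (s h₁ : ℤ) : (switchMod c s h₁ : ℤ) ∣ h₁ := by
  rw [switchMod, Int.natCast_natAbs, abs_dvd]
  exact Dvd.intro_left _ (Int.mul_ediv_cancel' (natCast_switchGcd_dvd c s h₁))

/-- **The divisor condition of the switch as a sum of the three level kernels.** For a level `q`, a Petersson index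
`c`, `h₁` a unit mod `q·c` with `2 ≤ q·c`, any `A, s ∈ ℤ` and `R ≥ 1`:
`𝟙[h₁ ∣ A + (qc)·s] = 𝟙[g ∣ A ∧ switchClass unit]·(levelPrincipal {q} 1 n + levelSmallPart R {q} 1 n a + levelLargePart R {q} 1 n a)`
with `g = switchGcd c s h₁`, `n = switchMod c s h₁`, `a = switchClass c A s h₁`. [folklore] -/
theorem ite_dvd_eq_kernels {q c : ℕ} (hqc : 2 ≤ q * c) {h₁ : ℤ} (hu : IsUnit ((h₁ : ℤ) : ZMod (q * c)))
    (A s : ℤ) {R : ℕ} (hR : 1 ≤ R) [Decidable ((switchGcd c s h₁ : ℤ) ∣ A ∧ IsUnit (switchClass c A s h₁))] :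
    (if h₁ ∣ A + ((q * c : ℕ) : ℤ) * s then (1 : ℂ) else 0) =
      if ((switchGcd c s h₁ : ℤ) ∣ A ∧ IsUnit (switchClass c A s h₁)) then
        (levelPrincipal {q} (fun _ ↦ (1 : ℂ)) (switchMod c s h₁) +
          levelSmallPart R {q} (fun _ ↦ (1 : ℂ)) (switchMod c s h₁) (switchClass c A s h₁) +
          levelLargePart R {q} (fun _ ↦ (1 : ℂ)) (switchMod c s h₁) (switchClass c A s h₁))
      else 0 := by
  classical
  haveI : NeZero (q * c) := ⟨by omega⟩
  have hh₁ : h₁ ≠ 0 := intCast_ne_zero_of_isUnit hqc hu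
  haveI hn0 : NeZero (switchMod c s h₁) := ⟨switchMod_ne_zero c s hh₁⟩
  obtain ⟨hcq, _⟩ := (isUnit_intCast_zmod_mul_iff h₁ q c).mp hu
  -- `q` is a unit modulo the reduced modulus (it is coprime to `h₁`, a multiple of the reduced modulus)
  have hqunit : IsUnit ((q : ℕ) : ZMod (switchMod c s h₁)) := by
    rw [ZMod.isUnit_iff_coprime]
    have h1 : IsCoprime (q : ℤ) (switchMod c s h₁ : ℤ) :=
      (hcq.symm.of_isCoprime_of_dvd_right (natCast_switchMod_dvd c s h₁))
    exact Nat.isCoprime_iff_coprime.mp h1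
  -- the divisor condition as a class condition on the reduced modulus
  have hgcd : Int.gcd ((c : ℤ) * s) h₁ = switchGcd c s h₁ := rfl
  have hdvd : (h₁ ∣ A + ((q * c : ℕ) : ℤ) * s) ↔
      ((switchGcd c s h₁ : ℤ) ∣ A ∧ ((q : ℕ) : ZMod (switchMod c s h₁)) = switchClass c A s h₁) := by
    rw [show A + ((q * c : ℕ) : ℤ) * s = A + (q : ℤ) * ((c : ℤ) * s) by push_cast; ring,
      dvd_add_mul_iff_of_gcd hh₁ hgcd, dvd_iff_natCast_level_eq (isCoprime_div_gcd hh₁ hgcd) q, Int.cast_natCast]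
    exact Iff.rfl
  -- the sum of the three kernels is the class indicator of the singleton
  have hsplit : ∀ {a : ZMod (switchMod c s h₁)}, IsUnit a →
      levelPrincipal {q} (fun _ ↦ (1 : ℂ)) (switchMod c s h₁) +
          levelSmallPart R {q} (fun _ ↦ (1 : ℂ)) (switchMod c s h₁) a +
          levelLargePart R {q} (fun _ ↦ (1 : ℂ)) (switchMod c s h₁) a =
        if ((q : ℕ) : ZMod (switchMod c s h₁)) = a then 1 else 0 := by
    intro a ha
    rw [← levelAPSum_eq_principal_add_smallPart_add_largePart {q} (fun _ ↦ (1 : ℂ)) ha hR, levelAPSum,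
      Finset.filter_singleton]
    split_ifs <;> simp
  by_cases hg : (switchGcd c s h₁ : ℤ) ∣ A
  · by_cases hua : IsUnit (switchClass c A s h₁)
    · rw [if_pos (show (switchGcd c s h₁ : ℤ) ∣ A ∧ IsUnit (switchClass c A s h₁) from ⟨hg, hua⟩), hsplit hua]
      by_cases hcl : ((q : ℕ) : ZMod (switchMod c s h₁)) = switchClass c A s h₁
      · rw [if_pos (hdvd.mpr ⟨hg, hcl⟩), if_pos hcl]
      · rw [if_neg (fun h : h₁ ∣ A + ((q * c : ℕ) : ℤ) * s ↦ hcl (hdvd.mp h).2), if_neg hcl]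
    · rw [if_neg (show ¬ ((switchGcd c s h₁ : ℤ) ∣ A ∧ IsUnit (switchClass c A s h₁)) from fun h ↦ hua h.2),
        if_neg]
      intro h
      exact hua ((hdvd.mp h).2 ▸ hqunit)
  · rw [if_neg (show ¬ ((switchGcd c s h₁ : ℤ) ∣ A ∧ IsUnit (switchClass c A s h₁)) from fun h ↦ hg h.1),
      if_neg (fun h : h₁ ∣ A + ((q * c : ℕ) : ℤ) * s ↦ hg (hdvd.mp h).1)]

/-- The three kernels are bounded by `1` in norm. [folklore] -/
theorem norm_kernels_le {q : ℕ} {n : ℕ} [NeZero n] (R : ℕ) (a : ZMod n) :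
    ‖levelPrincipal {q} (fun _ ↦ (1 : ℂ)) n‖ ≤ 1 ∧ ‖levelSmallPart R {q} (fun _ ↦ (1 : ℂ)) n a‖ ≤ 1 ∧
      ‖levelLargePart R {q} (fun _ ↦ (1 : ℂ)) n a‖ ≤ 1 := by
  classical
  have h1 : ∑ q' ∈ ({q} : Finset ℕ), ‖(fun _ : ℕ ↦ (1 : ℂ)) q'‖ = 1 := by simp
  refine ⟨?_, (norm_levelSmallPart_le {q} R a _).trans h1.le, (norm_levelLargePart_le {q} R a _).trans h1.le⟩
  have hφ1 : (1 : ℝ) ≤ (Nat.totient n : ℝ) := by exact_mod_cast Nat.totient_pos.mpr (NeZero.pos n)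
  have hS : ‖levelCoprimeSum {q} (fun _ ↦ (1 : ℂ)) n‖ ≤ 1 := by
    rw [levelCoprimeSum_eq_sum_ite, Finset.sum_singleton, mul_one]
    split_ifs <;> simp
  rw [levelPrincipal, norm_mul, norm_inv, Complex.norm_natCast]
  calc (Nat.totient n : ℝ)⁻¹ * _ ≤ 1 * 1 :=
        mul_le_mul (inv_le_one_of_one_le₀ hφ1) hS (norm_nonneg _) zero_le_one
    _ = 1 := one_mul _

/-! ### §5. The kernels against a level weight are prover-7's pieces of that weight -/

section Bridge

variable (Q : Finset ℕ) (F : ℕ → ℂ) (n : ℕ)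

/-- `Σ_{q∈Q} levelPrincipal {q} 1 n · F q = levelPrincipal Q F n`. [folklore] -/
theorem sum_levelPrincipal_singleton_mul :
    ∑ q ∈ Q, levelPrincipal {q} (fun _ ↦ (1 : ℂ)) n * F q = levelPrincipal Q F n := by
  classical
  simp only [levelPrincipal, levelCoprimeSum_eq_sum_ite, Finset.sum_singleton, mul_one, Finset.mul_sum]
  exact Finset.sum_congr rfl fun q _ ↦ by ring

/-- `Σ_{q∈Q} levelSmallPart R {q} 1 n a · F q = levelSmallPart R Q F n a`. [folklore] -/
theorem sum_levelSmallPart_singleton_mul (R : ℕ) (a : ZMod n) :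
    ∑ q ∈ Q, levelSmallPart R {q} (fun _ ↦ (1 : ℂ)) n a * F q = levelSmallPart R Q F n a := by
  classical
  simp only [levelSmallPart, Finset.sum_singleton, one_mul, Finset.mul_sum, Finset.sum_mul]
  rw [Finset.sum_comm]
  exact Finset.sum_congr rfl fun χ _ ↦ Finset.sum_congr rfl fun q _ ↦ by ring

/-- `Σ_{q∈Q} levelLargePart R {q} 1 n a · F q = levelLargePart R Q F n a` — `coreL`'s kernel IS prover-7's `L_R`. [folklore] -/
theorem sum_levelLargePart_singleton_mul (R : ℕ) (a : ZMod n) :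
    ∑ q ∈ Q, levelLargePart R {q} (fun _ ↦ (1 : ℂ)) n a * F q = levelLargePart R Q F n a := by
  classical
  simp only [levelLargePart, Finset.sum_singleton, one_mul, Finset.mul_sum, Finset.sum_mul]
  rw [Finset.sum_comm]
  exact Finset.sum_congr rfl fun χ _ ↦ Finset.sum_congr rfl fun q _ ↦ by ring

end Bridge

end Summit.Parity.GeneralizedHardyLittlewood.Theorems.BeyondDiagonalBeatsQuarter.OffDiag
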